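import Mathlib

/-!
# Word collisions: counting prerequisites for the single-colour reflection supply
# (crux `SnSubsetDichotomy.HyperoctahedralThreshold`, stmt-MatrixMultiplication-10883, refutation line)

Generic finite combinatorics used by the sibling file `…SameColourSupply.lean` (siege seat k23, variation
"direct pigeonhole on involution words"; crux NOTES §9 (S1), §15.1):

* the right action of colour words `x · w = w.foldl (fun v c => μ c v) x` (the line's convention) —
  `foldl_act_append`, `foldl_act_reverse`, `foldl_act_injective` (also in `…RotationIdentity.lean`,
  namespace `…Rotation`; repeated so that this file has no intra-project import);
* `card_redWords`: the reduced colour words of length `m` (consecutive letters distinct) not starting with a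
  given colour number exactly `2 ^ m` (registered for the `--supports` plumbing as `stub_cardReducedWords`);
* `card_sq_le_card_mul_card_sameImage`, `card_sameImage_eq_card_add_card_collisions`: for a map `F : X → Y`
  of finsets, `|X|² ≤ |Y| · #{(x, x') : F x = F x'}` (Cauchy–Schwarz on fibres) and the same-image pairs are
  the diagonal plus the COLLISIONS (ordered pairs of distinct elements with equal image);
* the split of two distinct words of equal length at their longest common suffix
  (`Nat.find (exists_drop_eq g g')` and its properties), and two `head?/getLast?` facts.

No definitions are introduced (sets of words are written out as filtered images of `List.Vector`).
-/

-- the project's summit namespace `Summit.MatrixMultiplication.MatrixMultiplication` repeats a component by design (D-0022)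
set_option linter.dupNamespace false

namespace Summit.MatrixMultiplication.MatrixMultiplication.Theorems.HyperoctahedralThreshold.SameColourSupply

open Finset

variable {n : ℕ}

/-! ### The right action of colour words (the line's convention `x · w = w.foldl (fun v c => μ c v) x`) -/

/-- A word followed by its reverse acts trivially (letters are involutions): `x · (w ++ w⁻¹) = x`.
(Cf. `…Rotation.foldl_act_reverse` in the sibling file `…RotationIdentity.lean`.) -/
theorem foldl_append_reverse_self (μ : Fin 3 → Equiv.Perm (Fin n)) (hμ : ∀ c, μ c * μ c = 1) :
    ∀ (w : List (Fin 3)) (x : Fin n), (w ++ w.reverse).foldl (fun v c => μ c v) x = x := by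
  intro w
  induction w with
  | nil => intro x; rfl
  | cons c w ih =>
    intro x
    rw [List.reverse_cons, List.cons_append, List.foldl_cons, ← List.append_assoc, List.foldl_append,
      ih, List.foldl_cons, List.foldl_nil]
    have : (μ c * μ c) x = x := by rw [hμ c]; rfl
    simpa using this

/-- Right cancellation of the action of a word: `x · w = y · w → x = y`. -/
theorem eq_of_foldl_act_eq (μ : Fin 3 → Equiv.Perm (Fin n)) (hμ : ∀ c, μ c * μ c = 1)
    (w : List (Fin 3)) {x y : Fin n}
    (hxy : w.foldl (fun v c => μ c v) x = w.foldl (fun v c => μ c v) y) : x = y := by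
  have e := congrArg (fun v => w.reverse.foldl (fun v c => μ c v) v) hxy
  rwa [← List.foldl_append, ← List.foldl_append, foldl_append_reverse_self μ hμ,
    foldl_append_reverse_self μ hμ] at e

/-! ### Reduced colour words with a forbidden first letter -/

/-- Membership in the `Finset` of reduced colour words of length `m` whose first letter is not `e`. -/
theorem mem_redWords {m : ℕ} {e : Fin 3} {g : List (Fin 3)} :
    g ∈ ((univ : Finset (List.Vector (Fin 3) m)).image (fun v => v.toList)).filter
        (fun g => List.IsChain (· ≠ ·) g ∧ g.head? ≠ some e) ↔
      g.length = m ∧ List.IsChain (· ≠ ·) g ∧ g.head? ≠ some e := by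
  rw [mem_filter]
  refine and_congr_left' ⟨fun h => ?_, fun h => mem_image.2 ⟨⟨g, h⟩, mem_univ _, rfl⟩⟩
  obtain ⟨v, -, rfl⟩ := mem_image.1 h
  exact v.toList_length

/-- **Counting reduced words.**  The reduced colour words of length `m` (consecutive letters distinct)
whose first letter is not `e` number exactly `2 ^ m`: each letter is one of the two colours different
from its predecessor (the predecessor of the first letter being `e`). [folklore] -/
theorem card_redWords : ∀ (m : ℕ) (e : Fin 3),
    (((univ : Finset (List.Vector (Fin 3) m)).image (fun v => v.toList)).filter
        (fun g => List.IsChain (· ≠ ·) g ∧ g.head? ≠ some e)).card = 2 ^ m := by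
  intro m
  induction m with
  | zero =>
    intro e
    rw [pow_zero, card_eq_one]
    refine ⟨[], ?_⟩
    ext g
    rw [mem_redWords, mem_singleton]
    constructor
    · rintro ⟨h, -, -⟩
      exact List.eq_nil_of_length_eq_zero h
    · rintro rfl
      exact ⟨rfl, List.IsChain.nil, by simp⟩
  | succ m ih =>
    intro e
    have key : ((univ.erase e).sigma (fun a => ((univ : Finset (List.Vector (Fin 3) m)).image
        (fun v => v.toList)).filter (fun g => List.IsChain (· ≠ ·) g ∧ g.head? ≠ some a))).card =
        (((univ : Finset (List.Vector (Fin 3) (m + 1))).image (fun v => v.toList)).filter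
          (fun g => List.IsChain (· ≠ ·) g ∧ g.head? ≠ some e)).card := by
      refine card_nbij' (fun ag => ag.1 :: ag.2) (fun g => ⟨g.headD e, g.tail⟩) ?_ ?_ ?_ ?_
      · rintro ⟨a, g⟩ h
        have h' := mem_sigma.1 (Finset.mem_coe.1 h)
        rw [mem_erase, mem_redWords] at h'
        obtain ⟨⟨hae, -⟩, hl, hc, hh⟩ := h'
        refine Finset.mem_coe.2 ?_
        rw [mem_redWords]
        refine ⟨by simpa using hl, ?_, by simpa using hae⟩
        rw [List.isChain_cons]
        refine ⟨?_, hc⟩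
        intro y hy hay
        apply hh
        rw [hay]
        exact Option.mem_def.1 hy
      · intro g hg
        have hg' := Finset.mem_coe.1 hg
        rw [mem_redWords] at hg'
        obtain ⟨hl, hc, hh⟩ := hg'
        obtain ⟨a, g', rfl⟩ : ∃ a g', g = a :: g' := by
          cases g with
          | nil => simp at hl
          | cons a g' => exact ⟨a, g', rfl⟩
        refine Finset.mem_coe.2 ?_
        rw [mem_sigma, mem_erase, mem_redWords]
        simp only [List.headD_cons, List.tail_cons]
        refine ⟨⟨?_, mem_univ _⟩, by simpa using hl, hc.tail, ?_⟩
        · intro hae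
          apply hh
          rw [hae]
          rfl
        · intro h'
          have := (List.isChain_cons.1 hc).1 a (Option.mem_def.2 h')
          exact this rfl
      · rintro ⟨a, g⟩ -
        rfl
      · intro g hg
        have hg' := Finset.mem_coe.1 hg
        rw [mem_redWords] at hg'
        obtain ⟨hl, -, -⟩ := hg'
        cases g with
        | nil => simp at hl
        | cons a g' => rfl
    rw [← key, card_sigma]
    simp_rw [ih]
    rw [sum_const, smul_eq_mul, card_erase_of_mem (mem_univ e), card_univ, Fintype.card_fin]
    ring

/-- Registered form (`stub_cardReducedWords`; `--supports` plumbing for crux stmt-MatrixMultiplication-10883):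
`card_redWords` verbatim. -/
theorem stub_cardReducedWords : ∀ (m : ℕ) (e : Fin 3), (((Finset.univ : Finset (List.Vector (Fin 3) m)).image (fun v => v.toList)).filter (fun g => List.IsChain (· ≠ ·) g ∧ g.head? ≠ some e)).card = 2 ^ m :=
  card_redWords

/-! ### Collisions of a map: Cauchy–Schwarz and the diagonal -/

/-- **Pigeonhole with multiplicity.**  For a map `F` sending a finset `X` into a finset `Y`, the ordered
pairs of elements of `X` with equal image number at least `|X|² / |Y|` (Cauchy–Schwarz on the fibre sizes:
`|X|² = (Σ_y |F⁻¹ y|)² ≤ |Y| Σ_y |F⁻¹ y|²`). [folklore] -/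
theorem card_sq_le_card_mul_card_sameImage {α β : Type*} [DecidableEq α] [DecidableEq β]
    (X : Finset α) (Y : Finset β) (F : α → β) (hF : ∀ x ∈ X, F x ∈ Y) :
    X.card ^ 2 ≤ Y.card * ((X ×ˢ X).filter (fun p => F p.1 = F p.2)).card := by
  have h1 : X.card = ∑ y ∈ Y, (X.filter (fun x => F x = y)).card :=
    card_eq_sum_card_fiberwise hF
  have h2 : ((X ×ˢ X).filter (fun p => F p.1 = F p.2)).card =
      ∑ y ∈ Y, (X.filter (fun x => F x = y)).card ^ 2 := by
    rw [card_eq_sum_card_fiberwise (f := fun p : α × α => F p.1) (t := Y) ?_]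
    · refine sum_congr rfl (fun y _ => ?_)
      rw [sq, ← card_product]
      congr 1
      ext ⟨x, x'⟩
      simp only [mem_filter, mem_product]
      constructor
      · rintro ⟨⟨⟨hx, hx'⟩, hF'⟩, hy'⟩
        exact ⟨⟨hx, hy'⟩, hx', by rw [← hF', hy']⟩
      · rintro ⟨⟨hx, hy'⟩, hx', hy''⟩
        exact ⟨⟨⟨hx, hx'⟩, by rw [hy', hy'']⟩, hy'⟩
    · intro p hp
      have hp' := mem_filter.1 (Finset.mem_coe.1 hp)
      exact hF _ (mem_product.1 hp'.1).1
  rw [h2, h1]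
  exact sq_sum_le_card_mul_sum_sq

/-- The ordered pairs with equal image split into the diagonal (`|X|` pairs) and the COLLISIONS, the
ordered pairs of distinct elements with equal image. [folklore] -/
theorem card_sameImage_eq_card_add_card_collisions {α β : Type*} [DecidableEq α] [DecidableEq β]
    (X : Finset α) (F : α → β) :
    ((X ×ˢ X).filter (fun p => F p.1 = F p.2)).card =
      X.card + ((X ×ˢ X).filter (fun p => p.1 ≠ p.2 ∧ F p.1 = F p.2)).card := by
  rw [← card_filter_add_card_filter_not (p := fun p : α × α => p.1 = p.2), filter_filter,
    filter_filter]
  congr 1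
  · rw [← diag_card X, diag_eq_filter]
    congr 1
    ext p
    simp only [mem_filter]
    constructor
    · rintro ⟨h, -, h2⟩
      exact ⟨h, h2⟩
    · rintro ⟨h, h2⟩
      exact ⟨h, by rw [h2], h2⟩
  · congr 1
    ext p
    simp only [mem_filter]
    tauto

/-- **Collision count.**  Consequently, if `F` maps `X` into `Y`, then
`|X|² ≤ |Y| · (|X| + #collisions)`. [folklore] -/
theorem card_sq_le_card_mul_collisions {α β : Type*} [DecidableEq α] [DecidableEq β]
    (X : Finset α) (Y : Finset β) (F : α → β) (hF : ∀ x ∈ X, F x ∈ Y) :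
    X.card ^ 2 ≤ Y.card * (X.card + ((X ×ˢ X).filter (fun p => p.1 ≠ p.2 ∧ F p.1 = F p.2)).card) := by
  rw [← card_sameImage_eq_card_add_card_collisions]
  exact card_sq_le_card_mul_card_sameImage X Y F hF

/-! ### Splitting two words at their longest common suffix -/

section Split

variable {α : Type*}

/-- Two lists agree after dropping enough letters. -/
theorem exists_drop_eq (g g' : List α) : ∃ d, g.drop d = g'.drop d :=
  ⟨max g.length g'.length, by
    rw [List.drop_eq_nil_of_le (le_max_left _ _), List.drop_eq_nil_of_le (le_max_right _ _)]⟩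

/-- The split index `D = Nat.find (exists_drop_eq g g')` (the length of the words minus the length of
their longest common suffix) satisfies `g.drop D = g'.drop D`. -/
theorem drop_find_eq [DecidableEq α] (g g' : List α) :
    g.drop (Nat.find (exists_drop_eq g g')) = g'.drop (Nat.find (exists_drop_eq g g')) :=
  Nat.find_spec (exists_drop_eq g g')

/-- The split index is at most any common bound on the lengths. -/
theorem find_le_of_length_le [DecidableEq α] {g g' : List α} {k : ℕ} (hg : g.length ≤ k) (hg' : g'.length ≤ k) :
    Nat.find (exists_drop_eq g g') ≤ k :=
  Nat.find_min' _ (by rw [List.drop_eq_nil_of_le hg, List.drop_eq_nil_of_le hg'])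

/-- The split index of two distinct words is positive. -/
theorem find_pos_of_ne [DecidableEq α] {g g' : List α} (hne : g ≠ g') : 0 < Nat.find (exists_drop_eq g g') := by
  rw [Nat.pos_iff_ne_zero]
  intro h0
  have h := drop_find_eq g g'
  rw [h0, List.drop_zero, List.drop_zero] at h
  exact hne h

/-- Just before the split index the two words differ (minimality). -/
theorem getElem_ne_of_find [DecidableEq α] {g g' : List α} {D : ℕ} (hD : D = Nat.find (exists_drop_eq g g'))
    (hpos : 0 < D) (h1 : D - 1 < g.length) (h2 : D - 1 < g'.length) : g[D - 1] ≠ g'[D - 1] := by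
  intro heq
  have hmin : ¬ g.drop (D - 1) = g'.drop (D - 1) := by
    have := Nat.find_min (exists_drop_eq g g') (m := D - 1) (by omega)
    exact this
  apply hmin
  have hdrop : g.drop D = g'.drop D := by
    rw [hD]
    exact drop_find_eq g g'
  rw [List.drop_eq_getElem_cons h1, List.drop_eq_getElem_cons h2, heq]
  have hD1 : D - 1 + 1 = D := by omega
  rw [hD1, hdrop]

/-- The last letter of a non-trivial prefix. -/
theorem getLast?_take {g : List α} {d : ℕ} (hpos : 0 < d) (hd : d ≤ g.length) :
    (g.take d).getLast? = some (g[d - 1]'(by omega)) := by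
  rw [List.getLast?_eq_getElem?, List.length_take, min_eq_left hd, List.getElem?_take,
    if_pos (by omega), List.getElem?_eq_getElem (by omega)]

end Split

section ListFacts

variable {α : Type*}

/-- The first letter of `g.take d ++ q` is the first letter of `g` (`d, |g| ≥ 1`). -/
theorem head?_take_append {g q : List α} {d : ℕ} (hd : 0 < d) (hg : 0 < g.length) :
    (g.take d ++ q).head? = g.head? := by
  cases g with
  | nil => simp at hg
  | cons e g1 =>
    cases d with
    | zero => omega
    | succ d => simp [List.take_succ_cons]

/-- The last letter of `q ++ (g.take d).reverse` is the first letter of `g` (`d, |g| ≥ 1`). -/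
theorem getLast?_append_reverse_take {g q : List α} {d : ℕ} (hd : 0 < d) (hg : 0 < g.length) :
    (q ++ (g.take d).reverse).getLast? = g.head? := by
  cases g with
  | nil => simp at hg
  | cons e g1 =>
    cases d with
    | zero => omega
    | succ d => simp [List.take_succ_cons]

end ListFacts


end Summit.MatrixMultiplication.MatrixMultiplication.Theorems.HyperoctahedralThreshold.SameColourSupply
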